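import Summits.QuantumFields.YangMills.Theorems.ComplexCouplingChannelHarmonicMeasureEngineTorusLegPrelims

/-!
# Uniformly Cauchy local free energies have a holomorphic limit — the local window

Helper file for the crux `FreeEnergyWindowChannel` (item `stmt-QuantumFields-18842`, route `ComplexCouplingChannel`
of `QuantumFields/YangMills`), line `Sketch` (transport), stub `stub_localWindowOfCauchy`.  Pure one-variable
complex analysis.

For a family `Z P : ℂ → ℂ` (`P : ℕ`, the symmetric-torus partition functions) holomorphic and zero-free on
`ball y (2s)` for `P ≥ P₀ ≥ 1`, whose normalised free energies `u_P := P⁻⁴ log ‖Z P‖` are UNIFORMLY CAUCHY there,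
`|u_P − u_Q| ≤ b P` for `P₀ ≤ P ≤ Q` with `0 < b P → 0`, we produce ONE holomorphic `f` on `ball y s` with
`|log ‖Z P z‖ + P⁴ Re f z| ≤ 5 P⁴ b P` for all `P ≥ P₀`, `z ∈ ball y s`.

Proof.  (1) For `P ≥ P₀`, `W_P w := Z P (y + w) / Z P y` is holomorphic, zero-free on `ball 0 (2s)` with
`W_P 0 = 1`, so `W_P = exp ∘ g_P` with `g_P 0 = 0` (tree `exists_differentiableOn_exp_eq`); the function
`φ_P z := P⁻⁴ (g_P (z − y) + log ‖Z P y‖)` is holomorphic on `ball y (2s)` with `Re φ_P = u_P` and `φ_P y` real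
(`exists_differentiableOn_re_eq_mul_log_norm`).  (2) For `P₀ ≤ P ≤ Q`, `φ_P − φ_Q` (shifted to the origin) has real
part `u_P − u_Q ≤ b P` and a real centre value of modulus `≤ b P`, so Borel–Carathéodory with `(R, r) = (2s, s)`
(tree `norm_le_of_re_le_of_norm_zero_le`) gives `‖φ_P − φ_Q‖ ≤ 5 b P` on `ball y s` (`norm_sub_le_five_mul`).
(3) Hence `(φ_P z)_P` is Cauchy for each `z ∈ ball y s`; its limit `F z` satisfies `‖φ_P z − F z‖ ≤ 5 b P`, so
`φ_P → F` uniformly on `ball y s` and `F` is holomorphic there (Mathlib `TendstoLocallyUniformlyOn.differentiableOn`).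
(4) With `f := −F`: `log ‖Z P z‖ + P⁴ Re f z = P⁴ Re (φ_P z − F z)`, of modulus `≤ 5 P⁴ b P`.

References: preliminaries in `ComplexCouplingChannelHarmonicMeasureEngineTorusLegPrelims.lean`
(`exists_differentiableOn_exp_eq`, `norm_le_of_re_le_of_norm_zero_le`); Mathlib
`TendstoLocallyUniformlyOn.differentiableOn`, `CauchySeq.tendsto_limUnder`.
-/

open Complex Metric Set Filter Topology

namespace Summit.QuantumFields.YangMills.Theorems.FreeEnergyWindowChannel

open Summit.QuantumFields.YangMills.Theorems.ComplexCouplingChannel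

/-- **A holomorphic branch of `c · log Z`, real at the centre.**  If `Z` is holomorphic and zero-free on
`ball y R`, then for every real `c` there is `φ` holomorphic on the ball with `Re φ = c · log ‖Z‖` there and
`φ y` real (normalised holomorphic logarithm of `Z (y + ·) / Z y`, tree `exists_differentiableOn_exp_eq`).
[folklore] -/
theorem exists_differentiableOn_re_eq_mul_log_norm {Z : ℂ → ℂ} {y : ℂ} {R : ℝ} (hR : 0 < R)
    (hZ : DifferentiableOn ℂ Z (ball y R)) (hZ0 : ∀ z ∈ ball y R, Z z ≠ 0) (c : ℝ) :
    ∃ φ : ℂ → ℂ, DifferentiableOn ℂ φ (ball y R) ∧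
      (∀ z ∈ ball y R, (φ z).re = c * Real.log ‖Z z‖) ∧ (φ y).im = 0 := by
  have hy : y ∈ ball y R := mem_ball_self hR
  have hZy : Z y ≠ 0 := hZ0 y hy
  have hZy' : 0 < ‖Z y‖ := norm_pos_iff.2 hZy
  have hsh : ∀ w ∈ ball (0 : ℂ) R, y + w ∈ ball y R := by
    intro w hw
    rw [mem_ball, dist_eq_norm, add_sub_cancel_left]
    exact mem_ball_zero_iff.1 hw
  have hsh' : ∀ z ∈ ball y R, z - y ∈ ball (0 : ℂ) R := fun z hz =>
    mem_ball_zero_iff.2 (mem_ball_iff_norm.1 hz)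
  -- the normalised shifted function and its holomorphic logarithm
  set W : ℂ → ℂ := fun w => Z (y + w) / Z y with hW_def
  have hWd : DifferentiableOn ℂ W (ball 0 R) :=
    (hZ.comp (differentiableOn_id.const_add y) hsh).div_const _
  have hW0 : ∀ w ∈ ball (0 : ℂ) R, W w ≠ 0 := fun w hw => div_ne_zero (hZ0 _ (hsh w hw)) hZy
  have hW1 : W 0 = 1 := by simp [hW_def, hZy]
  obtain ⟨g, hgd, hg0, hexp⟩ := exists_differentiableOn_exp_eq hR hWd hW0 hW1
  have hgre : ∀ w ∈ ball (0 : ℂ) R, (g w).re = Real.log ‖Z (y + w)‖ - Real.log ‖Z y‖ := by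
    intro w hw
    have h1 : Real.log ‖Complex.exp (g w)‖ = (g w).re := by rw [Complex.norm_exp, Real.log_exp]
    rw [← h1, hexp w hw, hW_def, norm_div,
      Real.log_div (norm_ne_zero_iff.2 (hZ0 _ (hsh w hw))) hZy'.ne']
  refine ⟨fun z => (c : ℂ) * (g (z - y) + (Real.log ‖Z y‖ : ℂ)), ?_, ?_, ?_⟩
  · exact (differentiableOn_const _).mul
      ((hgd.comp (differentiableOn_id.sub_const y) hsh').add_const _)
  · intro z hz
    have h := hgre (z - y) (hsh' z hz)
    rw [add_sub_cancel] at h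
    rw [Complex.re_ofReal_mul, Complex.add_re, Complex.ofReal_re, h]
    ring
  · show ((c : ℂ) * (g (y - y) + (Real.log ‖Z y‖ : ℂ))).im = 0
    rw [sub_self, hg0, zero_add, Complex.im_ofReal_mul, Complex.ofReal_im, mul_zero]

/-- **Borel–Carathéodory for a difference of two branches.**  If `φ, ψ` are holomorphic on `ball y (2s)`, both
real at the centre `y`, and `|Re φ − Re ψ| ≤ η` on the ball (`η > 0`), then `‖φ − ψ‖ ≤ 5 η` on `ball y s`
(tree `norm_le_of_re_le_of_norm_zero_le` with `(R, r) = (2s, s)`: `(2s + 3s)/(2s − s) = 5`). [folklore] -/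
theorem norm_sub_le_five_mul {φ ψ : ℂ → ℂ} {y : ℂ} {s η : ℝ} (hs : 0 < s) (hη : 0 < η)
    (hφ : DifferentiableOn ℂ φ (ball y (2 * s))) (hψ : DifferentiableOn ℂ ψ (ball y (2 * s)))
    (hre : ∀ z ∈ ball y (2 * s), |(φ z).re - (ψ z).re| ≤ η) (hφy : (φ y).im = 0)
    (hψy : (ψ y).im = 0) : ∀ z ∈ ball y s, ‖φ z - ψ z‖ ≤ 5 * η := by
  have hsh : ∀ w ∈ ball (0 : ℂ) (2 * s), y + w ∈ ball y (2 * s) := by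
    intro w hw
    rw [mem_ball, dist_eq_norm, add_sub_cancel_left]
    exact mem_ball_zero_iff.1 hw
  -- the shifted difference
  set χ : ℂ → ℂ := fun w => φ (y + w) - ψ (y + w) with hχ_def
  have hχd : DifferentiableOn ℂ χ (ball 0 (2 * s)) :=
    (hφ.comp (differentiableOn_id.const_add y) hsh).sub (hψ.comp (differentiableOn_id.const_add y) hsh)
  have hχre : ∀ w ∈ ball (0 : ℂ) (2 * s), (χ w).re ≤ η := by
    intro w hw
    have h := hre (y + w) (hsh w hw)
    rw [hχ_def, Complex.sub_re]
    exact (le_abs_self _).trans h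
  have hχ0 : ‖χ 0‖ ≤ η := by
    have h0 : χ 0 = φ y - ψ y := by simp only [hχ_def, add_zero]
    have him : (χ 0).im = 0 := by rw [h0, Complex.sub_im, hφy, hψy, sub_zero]
    rw [← Complex.abs_re_eq_norm.2 him, h0, Complex.sub_re]
    exact hre y (mem_ball_self (by positivity))
  intro z hz
  have hzs : ‖z - y‖ < s := mem_ball_iff_norm.1 hz
  have hBC := norm_le_of_re_le_of_norm_zero_le (R := 2 * s) (r := s) hs.le (by linarith) hη hχd hχre hχ0
    hzs.le
  have h5 : η * ((2 * s + 3 * s) / (2 * s - s)) = 5 * η := by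
    field_simp
    ring
  have hχz : χ (z - y) = φ z - ψ z := by simp only [hχ_def, add_sub_cancel]
  rw [h5, hχz] at hBC
  exact hBC

/-- **LOCAL WINDOW FROM A UNIFORMLY CAUCHY FAMILY OF FREE ENERGIES.**  Let `Z P` (`P ≥ P₀ ≥ 1`) be holomorphic and
zero-free on `ball y (2s)` and let the normalised free energies `P⁻⁴ log ‖Z P‖` be uniformly Cauchy there with a
positive rate `b P → 0`: `|P⁻⁴ log ‖Z P z‖ − Q⁻⁴ log ‖Z Q z‖| ≤ b P` for `P₀ ≤ P ≤ Q`.  Then there is ONE `f`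
holomorphic on `ball y s` with `|log ‖Z P z‖ + P⁴ Re f z| ≤ 5 P⁴ b P` for all `P ≥ P₀` and `z ∈ ball y s`.
Proof: holomorphic branches `φ_P` of `P⁻⁴ log Z P`, real at `y` (`exists_differentiableOn_re_eq_mul_log_norm`);
Borel–Carathéodory for `φ_P − φ_Q` (`norm_sub_le_five_mul`) gives `‖φ_P − φ_Q‖ ≤ 5 b P` on `ball y s`; the
pointwise limit `F` (ℂ complete) satisfies `‖φ_P − F‖ ≤ 5 b P`, hence is a uniform limit, holomorphic by
`TendstoLocallyUniformlyOn.differentiableOn`; take `f := −F`. [folklore] -/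
theorem stub_localWindowOfCauchy :
    ∀ (Z : ℕ → ℂ → ℂ) (y : ℂ) (s : ℝ) (P₀ : ℕ) (b : ℕ → ℝ), 0 < s → 1 ≤ P₀ →
      (∀ P : ℕ, P₀ ≤ P → DifferentiableOn ℂ (Z P) (Metric.ball y (2 * s))) →
      (∀ P : ℕ, P₀ ≤ P → ∀ z ∈ Metric.ball y (2 * s), Z P z ≠ 0) →
      (∀ P : ℕ, 0 < b P) → Filter.Tendsto b Filter.atTop (nhds 0) →
      (∀ P Q : ℕ, P₀ ≤ P → P ≤ Q → ∀ z ∈ Metric.ball y (2 * s),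
        |((P : ℝ) ^ 4)⁻¹ * Real.log ‖Z P z‖ - ((Q : ℝ) ^ 4)⁻¹ * Real.log ‖Z Q z‖| ≤ b P) →
      ∃ f : ℂ → ℂ, DifferentiableOn ℂ f (Metric.ball y s) ∧
        ∀ P : ℕ, P₀ ≤ P → ∀ z ∈ Metric.ball y s,
          |Real.log ‖Z P z‖ + (P : ℝ) ^ 4 * (f z).re| ≤ 5 * (P : ℝ) ^ 4 * b P := by
  intro Z y s P₀ b hs hP₀ hZd hZ0 hb0 hb hC
  have h2s : 0 < 2 * s := by positivity
  have hsub : ball y s ⊆ ball y (2 * s) := ball_subset_ball (by linarith)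
  -- Step 1: holomorphic branches `φ P` of `P⁻⁴ log Z P`, real at the centre (a dummy for `P < P₀`)
  have hex : ∀ P : ℕ, ∃ φ : ℂ → ℂ, P₀ ≤ P →
      DifferentiableOn ℂ φ (ball y (2 * s)) ∧
        (∀ z ∈ ball y (2 * s), (φ z).re = ((P : ℝ) ^ 4)⁻¹ * Real.log ‖Z P z‖) ∧ (φ y).im = 0 := by
    intro P
    by_cases hP : P₀ ≤ P
    · obtain ⟨φ, hφ⟩ :=
        exists_differentiableOn_re_eq_mul_log_norm h2s (hZd P hP) (hZ0 P hP) (((P : ℝ) ^ 4)⁻¹)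
      exact ⟨φ, fun _ => hφ⟩
    · exact ⟨0, fun h => absurd h hP⟩
  choose φ hφ using hex
  -- Step 2: `‖φ P z - φ Q z‖ ≤ 5 b P` on `ball y s` for `P₀ ≤ P ≤ Q` (Borel–Carathéodory)
  have hdist : ∀ P Q : ℕ, P₀ ≤ P → P ≤ Q → ∀ z ∈ ball y s, ‖φ P z - φ Q z‖ ≤ 5 * b P := by
    intro P Q hP hPQ
    obtain ⟨hPd, hPre, hPy⟩ := hφ P hP
    obtain ⟨hQd, hQre, hQy⟩ := hφ Q (hP.trans hPQ)
    refine norm_sub_le_five_mul hs (hb0 P) hPd hQd (fun z hz => ?_) hPy hQy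
    rw [hPre z hz, hQre z hz]
    exact hC P Q hP hPQ z hz
  -- Step 3: the pointwise limit `F` on `ball y s`
  have hcauchy : ∀ z ∈ ball y s, CauchySeq fun P => φ P z := by
    intro z hz
    refine Metric.cauchySeq_iff'.2 fun ε hε => ?_
    obtain ⟨N, hN⟩ := Filter.eventually_atTop.1
      (hb.eventually (eventually_lt_nhds (show (0 : ℝ) < ε / 5 by positivity)))
    refine ⟨max N P₀, fun n hn => ?_⟩
    rw [dist_comm, dist_eq_norm]
    have h1 := hdist (max N P₀) n (le_max_right _ _) hn z hz
    have h2 := hN (max N P₀) (le_max_left _ _)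
    linarith
  set F : ℂ → ℂ := fun z => limUnder atTop fun P => φ P z with hF_def
  have hF : ∀ z ∈ ball y s, Tendsto (fun P => φ P z) atTop (𝓝 (F z)) := fun z hz =>
    (hcauchy z hz).tendsto_limUnder
  -- Step 4: `‖φ P z - F z‖ ≤ 5 b P` (pass to the limit `Q → ∞`)
  have hbound : ∀ P : ℕ, P₀ ≤ P → ∀ z ∈ ball y s, ‖φ P z - F z‖ ≤ 5 * b P := by
    intro P hP z hz
    have hT : Tendsto (fun Q => ‖φ P z - φ Q z‖) atTop (𝓝 ‖φ P z - F z‖) :=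
      (tendsto_const_nhds.sub (hF z hz)).norm
    exact le_of_tendsto hT (Filter.eventually_atTop.2 ⟨P, fun Q hQ => hdist P Q hP hQ z hz⟩)
  -- Step 5: uniform convergence on `ball y s`, holomorphy of the limit
  have hunif : TendstoUniformlyOn φ F atTop (ball y s) := by
    refine Metric.tendstoUniformlyOn_iff.2 fun ε hε => ?_
    have h1 : ∀ᶠ P in atTop, b P < ε / 5 := hb.eventually (eventually_lt_nhds (by positivity))
    filter_upwards [h1, Filter.eventually_ge_atTop P₀] with P hP1 hP2 z hz
    rw [dist_comm, dist_eq_norm]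
    have h2 := hbound P hP2 z hz
    linarith
  have hFd : DifferentiableOn ℂ F (ball y s) :=
    hunif.tendstoLocallyUniformlyOn.differentiableOn
      (Filter.eventually_atTop.2 ⟨P₀, fun P hP => (hφ P hP).1.mono hsub⟩) isOpen_ball
  -- Step 6: `f := -F`
  refine ⟨fun z => -F z, hFd.neg, ?_⟩
  intro P hP z hz
  show |Real.log ‖Z P z‖ + (P : ℝ) ^ 4 * (-F z).re| ≤ 5 * (P : ℝ) ^ 4 * b P
  have hP1 : (1 : ℝ) ≤ (P : ℝ) := by exact_mod_cast hP₀.trans hP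
  have hP4 : (0 : ℝ) < (P : ℝ) ^ 4 := by positivity
  have hre : (φ P z).re = ((P : ℝ) ^ 4)⁻¹ * Real.log ‖Z P z‖ := (hφ P hP).2.1 z (hsub hz)
  have hkey : Real.log ‖Z P z‖ + (P : ℝ) ^ 4 * (-F z).re = (P : ℝ) ^ 4 * (φ P z - F z).re := by
    rw [Complex.neg_re, Complex.sub_re, hre]
    field_simp
    ring
  rw [hkey, abs_mul, abs_of_pos hP4]
  calc (P : ℝ) ^ 4 * |(φ P z - F z).re| ≤ (P : ℝ) ^ 4 * ‖φ P z - F z‖ :=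
        mul_le_mul_of_nonneg_left (Complex.abs_re_le_norm _) hP4.le
    _ ≤ (P : ℝ) ^ 4 * (5 * b P) := mul_le_mul_of_nonneg_left (hbound P hP z hz) hP4.le
    _ = 5 * (P : ℝ) ^ 4 * b P := by ring

end Summit.QuantumFields.YangMills.Theorems.FreeEnergyWindowChannel
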